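import Summits.ResolutionOfSingularities.ResolutionOfSingularities.Theorems.FrobeniusLadderFInjectiveMacaulayficationTauFloorInputLegal
import Summits.ResolutionOfSingularities.ResolutionOfSingularities.Theorems.FrobeniusLadderFInjectiveMacaulayficationTauFloorInputNotFull
import Summits.ResolutionOfSingularities.ResolutionOfSingularities.Theorems.FrobeniusLadderFInjectiveMacaulayficationStrictTransformChartN
import Summits.ResolutionOfSingularities.ResolutionOfSingularities.Theorems.FrobeniusLadderFInjectiveMacaulayficationPrimeTransfer
import Summits.ResolutionOfSingularities.ResolutionOfSingularities.Theorems.FrobeniusLadderFInjectiveMacaulayficationReesChartFacts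
import Summits.ResolutionOfSingularities.ResolutionOfSingularities.Theorems.FrobeniusLadderFInjectiveMacaulayficationDoublePointFermatCubicGerm
import Summits.ResolutionOfSingularities.ResolutionOfSingularities.Theorems.FrobeniusLadderFInjectiveMacaulayficationGermOfGlobalBlowup
import HarnessLib

/-!
# Q9 «GENERIC POINT-FLOOR LEGALITY FOR ISOLATED HYPERSURFACE SINGULARITIES»: for `f ∈ k[X₀..X_{n−1}]` prime with an isolated singular point at the origin `v`,
# EVERY blowing up of `Spec 𝒪_{X,v}` along `𝔪̃_v` is a legal (admissible, CM) floor
# (crux `FInjectiveMacaulayfication` stmt-ResolutionOfSingularities-15315, chain w45a; res-L1-w45a-plan-1 g21 RULING R21.5 (3) Q9; = this seat's four bed-specific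
# `pointFloor_…_input_legal` (✓ p639147 / p640621 / p640799 / p647478) made ONE theorem, generic in `n` and `f`; consumers: Q8c (stub-1), (W-p3), (W-AS), every future
# point-floor row; seat res-L1-w45a-stub-3 g10)

[OURS · L1 W4.5a] Support file (`--supports stmt-ResolutionOfSingularities-15315 --as helper`); unconditional; def-free; characteristic-free; replaces the role of NO
printed item; NOT a statement of the manuscript; AI-written (AI review is weaker than expert review).

INPUT BINDERS (all elementary for a concrete bed — `ring` identities and evaluations): `f` prime; `0 < n`; the `n` strict transforms under the point blow-up,
`θ_i f = X_i^{μ i} · g i` (`θ_i : X_j ↦ X_j X_i`, `j ≠ i`), with `f ∉ (X_i)` and `g i ∉ (X_i)` — the chartwise PRIMALITY of `g i` is then DERIVED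
(`PrimeTransfer.prime_transform_of_prime`), not assumed; the origin `v` (`v = (x̄₀,…,x̄_{n−1})`) is NOT regular and every proper generization of `v` IS regular.
* §1 `isPrime_span_strictTransform`, ★ `cmCl_reesChart` (every Rees chart `D(x̄_i t)` of `Bl_𝔪 X` is the hypersurface ring `k[X]/(g i)` —
  `StrictTransformChartN.stub_strictTransformChartN` — hence CM at every prime), ★ `cmCl_stalk_affineBlowup`, `support_specializes`, `origin_ne_bot`;
* §2 ★★★ `pointFloor_input_legal` — for EVERY blowing up `g : S′ → Spec 𝒪_{X,v}` along `𝔪̃|_{Spec 𝒪_{X,v}}`: (i) the centre is `≠ ⊥`; (ii) its support lies in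
  `(Reg Spec 𝒪_{X,v})ᶜ`; (iii) `S′` is regular off the closed fibre; (iv) `S′` is CM at every stalk (res-L1-w45a-stub-1's `TauFloorInputLegal.offFibre_regular_and_cmCl`
  glue over the global model `affineBlowup 𝔪`).
[folklore assembly; cite: GortzWedhorn2020, Prop. 13.91 (2), (13.19); StacksProject, Tag 02OS and Tag 0804; Temkin2008, §2.1; Matsumura1987, Thm. 17.4]
-/

-- single-problem summit: the doubled namespace component is forced
set_option linter.dupNamespace false

noncomputable section

namespace Summit.ResolutionOfSingularities.ResolutionOfSingularities.Theorems.FInjectiveMacaulayfication.PointFloorLegalOfIsolated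

open CategoryTheory CategoryTheory.Limits AlgebraicGeometry TopologicalSpace IsLocalRing MvPolynomial
open Literature.AlgebraicGeometry.Resolution
open Summit.ResolutionOfSingularities.ResolutionOfSingularities.Theorems.FInjectiveMacaulayfication
open SliceableCentre GermOfGlobalBlowup

variable (k : Type) [Field k] {n : ℕ}

/-! ## §1 The charts of the point blow-up of a hypersurface are hypersurfaces — CM at every prime -/

/-- **The strict transforms are prime** (prime transfer along `θ_i` from `f`): no primality of `g i` needs to be ASSUMED. [folklore; `PrimeTransfer.prime_transform_of_prime`] -/
theorem isPrime_span_strictTransform (f : MvPolynomial (Fin n) k) (hf : Prime f) (μ : Fin n → ℕ) (g : Fin n → MvPolynomial (Fin n) k)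
    (hθ : ∀ i : Fin n, aeval (fun j : Fin n => if j = i then (X i : MvPolynomial (Fin n) k) else X j * X i) f = X i ^ μ i * g i)
    (hfX : ∀ i : Fin n, f ∉ Ideal.span {(X i : MvPolynomial (Fin n) k)}) (hgX : ∀ i : Fin n, g i ∉ Ideal.span {(X i : MvPolynomial (Fin n) k)}) (i : Fin n) :
    Prime (g i) ∧ (Ideal.span {g i}).IsPrime ∧ (X i : MvPolynomial (Fin n) k) ∉ Ideal.span {g i} := by
  have hgp : Prime (g i) := by
    refine PrimeTransfer.prime_transform_of_prime ((aeval fun j : Fin n => if j = i then (X i : MvPolynomial (Fin n) k) else X j * X i).toRingHom)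
      (fun c => ?_) ?_ (fun j hj => ?_) (hθ i) (hfX i) (hgX i) hf
    · show aeval _ (C c) = C c
      rw [aeval_C]; rfl
    · show aeval _ (X i) = X i
      rw [aeval_X, if_pos rfl]
    · show aeval _ (X j) = X j * X i
      rw [aeval_X, if_neg hj]
  have hgprime : (Ideal.span {g i}).IsPrime := (Ideal.span_singleton_prime hgp.ne_zero).mpr hgp
  exact ⟨hgp, hgprime, PrimeTransfer.X_not_mem_span_of_isPrime hgprime (hgX i)⟩

set_option maxHeartbeats 800000 in
-- chart-ring types are expensive to unify (as in `StrictTransformChartN`)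
/-- ★ **Every Rees chart `D(x̄ᵢt)` of `Bl_𝔪 X` is CM at EVERY prime**: it is the hypersurface ring `k[X]/(gᵢ)` (`stub_strictTransformChartN`), and hypersurfaces in
regular rings are CM (`DoublePointFermatCubicGerm.cmCl_localization_hypersurface`). [cite: Matsumura1987, Thm. 17.4 (iii), Thm. 17.8] -/
theorem cmCl_reesChart (f : MvPolynomial (Fin n) k) (hf : Prime f) (μ : Fin n → ℕ) (g : Fin n → MvPolynomial (Fin n) k)
    (hθ : ∀ i : Fin n, aeval (fun j : Fin n => if j = i then (X i : MvPolynomial (Fin n) k) else X j * X i) f = X i ^ μ i * g i)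
    (hfX : ∀ i : Fin n, f ∉ Ideal.span {(X i : MvPolynomial (Fin n) k)}) (hgX : ∀ i : Fin n, g i ∉ Ideal.span {(X i : MvPolynomial (Fin n) k)}) (i : Fin n)
    (q : Ideal (HomogeneousLocalization.Away (reesGrading (Ideal.span (Set.range (fun j : Fin n => Ideal.Quotient.mk (Ideal.span {f}) (X j)))))
      (reesT ((fun j : Fin n => Ideal.Quotient.mk (Ideal.span {f}) (X j)) i) (Ideal.subset_span (Set.mem_range_self i))))) [q.IsPrime] :
    CMCl (Localization.AtPrime q) := by
  have hfprime : (Ideal.span {f}).IsPrime := (Ideal.span_singleton_prime hf.ne_zero).mpr hf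
  obtain ⟨hgp, hgprime, hXi⟩ := isPrime_span_strictTransform k f hf μ g hθ hfX hgX i
  obtain ⟨e, -⟩ := StrictTransformChartN.stub_strictTransformChartN k n f (g i) i (μ i) hfprime hf.ne_zero hgprime hXi (hθ i)
    (fun j : Fin n => Ideal.Quotient.mk (Ideal.span {f}) (X j)) rfl
  exact ReesChartFacts.transport_cmCl e (fun Q _ => DoublePointFermatCubicGerm.cmCl_localization_hypersurface k _ hgp.ne_zero ⟨Q, inferInstance⟩) q

/-- ★ **`Bl_𝔪 X = affineBlowup 𝔪` satisfies the CM clause at EVERY point.** [folklore assembly; cite: StacksProject, Tag 0804] -/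
theorem cmCl_stalk_affineBlowup (f : MvPolynomial (Fin n) k) (hf : Prime f) (μ : Fin n → ℕ) (g : Fin n → MvPolynomial (Fin n) k)
    (hθ : ∀ i : Fin n, aeval (fun j : Fin n => if j = i then (X i : MvPolynomial (Fin n) k) else X j * X i) f = X i ^ μ i * g i)
    (hfX : ∀ i : Fin n, f ∉ Ideal.span {(X i : MvPolynomial (Fin n) k)}) (hgX : ∀ i : Fin n, g i ∉ Ideal.span {(X i : MvPolynomial (Fin n) k)})
    (y : ↥(affineBlowup (Ideal.span (Set.range (fun j : Fin n => Ideal.Quotient.mk (Ideal.span {f}) (X j)))))) :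
    CMCl ((affineBlowup (Ideal.span (Set.range (fun j : Fin n => Ideal.Quotient.mk (Ideal.span {f}) (X j))))).presheaf.stalk y) :=
  TauFloorInputLegal.cmCl_stalk_affineBlowup_of_charts (fun j : Fin n => Ideal.Quotient.mk (Ideal.span {f}) (X j))
    (fun i _ q _ => cmCl_reesChart k f hf μ g hθ hfX hgX i q) y

/-- The support of `𝔪̃` does not generize past the origin. [plumbing] -/
theorem support_specializes (f : MvPolynomial (Fin n) k) (v : Spec (.of (MvPolynomial (Fin n) k ⧸ Ideal.span {f})))
    (hv : v.asIdeal = Ideal.span (Set.range (fun j : Fin n => Ideal.Quotient.mk (Ideal.span {f}) (X j)))) :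
    ∀ y ∈ (((affineBlowup.idealSheaf (Ideal.span (Set.range (fun j : Fin n => Ideal.Quotient.mk (Ideal.span {f}) (X j)))))).support : Set (Spec (.of (MvPolynomial (Fin n) k ⧸ Ideal.span {f})))), y ⤳ v → y = v := by
  intro y hy hyv
  rw [affineBlowup.support_idealSheaf] at hy
  have h1 : v.asIdeal ≤ y.asIdeal := by rw [hv]; exact fun a ha => hy ha
  have h2 : y.asIdeal ≤ v.asIdeal := (PrimeSpectrum.le_iff_specializes y v).mpr hyv
  exact PrimeSpectrum.ext (le_antisymm h2 h1)

/-- The origin ideal `𝔪 = (x̄₀, …, x̄_{n−1})` is nonzero (`n ≥ 1`, `f ∉ (X₀)`). [plumbing] -/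
theorem origin_ne_bot (f : MvPolynomial (Fin n) k) (hf : Prime f) (hn : 0 < n) (hfX : ∀ i : Fin n, f ∉ Ideal.span {(X i : MvPolynomial (Fin n) k)}) :
    Ideal.span (Set.range (fun j : Fin n => Ideal.Quotient.mk (Ideal.span {f}) (X j))) ≠ ⊥ := by
  intro h0
  have hfprime : (Ideal.span {f}).IsPrime := (Ideal.span_singleton_prime hf.ne_zero).mpr hf
  have hmem : Ideal.Quotient.mk (Ideal.span {f}) (X (⟨0, hn⟩ : Fin n)) ∈ Ideal.span (Set.range (fun j : Fin n => Ideal.Quotient.mk (Ideal.span {f}) (X j))) := Ideal.subset_span ⟨⟨0, hn⟩, rfl⟩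
  rw [h0, Ideal.mem_bot] at hmem
  exact PrimeTransfer.X_not_mem_span_of_isPrime hfprime (hfX ⟨0, hn⟩) (Ideal.Quotient.eq_zero_iff_mem.mp hmem)

/-! ## §2 ★★★ The point floor of an isolated hypersurface singularity is a legal input -/

/-- ★★★ **GENERIC POINT-FLOOR LEGALITY.** `f ∈ k[X₀..X_{n−1}]` prime (`n ≥ 1`), with strict transforms `θ_i f = X_i^{μ i} g_i`, `f, g_i ∉ (X_i)`; `v` the origin of
`X = Spec k[X]/(f)`, NOT regular, every proper generization of `v` regular (an ISOLATED singular point along `v`'s generizations). Then for EVERY blowing up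
`g : S′ → Spec 𝒪_{X,v}` along `𝔪̃|_{Spec 𝒪_{X,v}}`: (i) the centre is `≠ ⊥`; (ii) its support lies in `(Reg Spec 𝒪_{X,v})ᶜ`; (iii) `S′` is regular off the closed
fibre; (iv) `S′` is CM at every stalk. [folklore assembly; cite: GortzWedhorn2020, Prop. 13.91 (2)] [cite: StacksProject, Tag 02OS; Tag 0804] [cite: Temkin2008, §2.1] -/
theorem pointFloor_input_legal (f : MvPolynomial (Fin n) k) (hf : Prime f) (hn : 0 < n) (μ : Fin n → ℕ) (g : Fin n → MvPolynomial (Fin n) k)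
    (hθ : ∀ i : Fin n, aeval (fun j : Fin n => if j = i then (X i : MvPolynomial (Fin n) k) else X j * X i) f = X i ^ μ i * g i)
    (hfX : ∀ i : Fin n, f ∉ Ideal.span {(X i : MvPolynomial (Fin n) k)}) (hgX : ∀ i : Fin n, g i ∉ Ideal.span {(X i : MvPolynomial (Fin n) k)})
    (v : Spec (.of (MvPolynomial (Fin n) k ⧸ Ideal.span {f}))) (hv : v.asIdeal = Ideal.span (Set.range (fun j : Fin n => Ideal.Quotient.mk (Ideal.span {f}) (X j))))
    (hsing : v ∉ Scheme.regularLocus (Spec (.of (MvPolynomial (Fin n) k ⧸ Ideal.span {f}))))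
    (hreg : ∀ y : Spec (.of (MvPolynomial (Fin n) k ⧸ Ideal.span {f})), y ⤳ v → y ≠ v → y ∈ Scheme.regularLocus (Spec (.of (MvPolynomial (Fin n) k ⧸ Ideal.span {f}))))
    (S' : Scheme.{0}) (g' : S' ⟶ Spec ((Spec (.of (MvPolynomial (Fin n) k ⧸ Ideal.span {f}))).presheaf.stalk v))
    (hg' : IsBlowup g' ((affineBlowup.idealSheaf (Ideal.span (Set.range (fun j : Fin n => Ideal.Quotient.mk (Ideal.span {f}) (X j))))).comap ((Spec (.of (MvPolynomial (Fin n) k ⧸ Ideal.span {f}))).fromSpecStalk v))) :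
    ((affineBlowup.idealSheaf (Ideal.span (Set.range (fun j : Fin n => Ideal.Quotient.mk (Ideal.span {f}) (X j))))).comap ((Spec (.of (MvPolynomial (Fin n) k ⧸ Ideal.span {f}))).fromSpecStalk v)) ≠ ⊥ ∧
    ((((affineBlowup.idealSheaf (Ideal.span (Set.range (fun j : Fin n => Ideal.Quotient.mk (Ideal.span {f}) (X j))))).comap ((Spec (.of (MvPolynomial (Fin n) k ⧸ Ideal.span {f}))).fromSpecStalk v)).support : Set (Spec ((Spec (.of (MvPolynomial (Fin n) k ⧸ Ideal.span {f}))).presheaf.stalk v))) ⊆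
      (Scheme.regularLocus (Spec ((Spec (.of (MvPolynomial (Fin n) k ⧸ Ideal.span {f}))).presheaf.stalk v)))ᶜ) ∧
    (∀ s : S', g'.base s ≠ closedPoint ((Spec (.of (MvPolynomial (Fin n) k ⧸ Ideal.span {f}))).presheaf.stalk v) → s ∈ Scheme.regularLocus S') ∧
    (∀ s : S', CMCl (S'.presheaf.stalk s)) := by
  classical
  haveI : (Ideal.span {f}).IsPrime := (Ideal.span_singleton_prime hf.ne_zero).mpr hf
  haveI : IsDomain (MvPolynomial (Fin n) k ⧸ Ideal.span {f}) := Ideal.Quotient.isDomain _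
  haveI : IsIntegral (Spec (.of (MvPolynomial (Fin n) k ⧸ Ideal.span {f}))) := inferInstance
  have hsupp := support_specializes k f v hv
  have h34 := TauFloorInputLegal.offFibre_regular_and_cmCl v (affineBlowup.isBlowup _) hsupp hreg
    (cmCl_stalk_affineBlowup k f hf μ g hθ hfX hgX) hg'
  exact ⟨comap_fromSpecStalk_ne_bot (affineBlowup.idealSheaf_ne_bot (origin_ne_bot k f hf hn hfX)) v,
    TauFloorInputLegal.support_comap_subset_compl_regularLocus v _ hsupp hsing, h34.1, h34.2⟩

end Summit.ResolutionOfSingularities.ResolutionOfSingularities.Theorems.FInjectiveMacaulayfication.PointFloorLegalOfIsolated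

end
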